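import Summits.Ventures.LatticeQCDFlow.Exactness.IMHEveryStartObservableRateUnboundedWeights
import HarnessLib

/-!
# The coupled flow-MCMC estimator from ANY configuration is exactly unbiased for EVERY flow and EVERY target — no bound, no moment condition —
# with expected overhead `≤ (max(1, w(x)) + 1)/ā` rounds: `E f(Y_k) + E[Σ_{n≥0}(f(X′_{k+n}) − f(Y_{k+n}))] = π f`

HONEST FRAMING: exact (Metropolis-corrected) sampling algorithms for lattice gauge theory;
figures of merit are autocorrelation/cost numbers at stated couplings and volumes; no
continuum-physics claim.

Venture `LatticeQCDFlow` (cell pub-lqcd), topic `Exactness`; FANOUT row 30 (lean-1, GEN-40).  NEW WORK of the cell (standard Borel `Ω`,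
`MeasurableEq Ω`; every proposal law); the capstone of this generation's unbounded-weight files.  `…CoupledUnbiasedEstimatorUnboundedWeights` proved
exact unbiasedness from a configuration `x` under `∫ w dπ = ∫ w² dq < ∞` — a hypothesis used ONLY to identify the limit of the production run through a
STATIONARY witness run.  Here the limit is identified instead by this generation's every-start rate (`…EveryStartObservableRateUnboundedWeights`:
`|π f − (δ_xK^b) f| ≤ (c − a)(π{w > M} + (1 − c₁/max(1, w(x), M))^b)`, no moment condition), and the summability of the corrections by the practical-start
bound `∫_{Δᶜ} max(1, w, w′) dν̂_x ≤ max(1, w(x)) + 1` (`…MeetingTimeUnboundedWeights` §4).  Setting: `K = indepMH q w`, `0 < w` measurable, `π = w·q` a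
probability law — NOTHING ELSE; CRN pair kernel `K̂`; `ν̂_x = (δ_xK) ⊗ δ_x` (production run at `x`, leading run one independent update out of `x`);
`a ≤ f ≤ c` measurable:

* §1 **`tendsto_measure_weight_gt_atTop`** — `π{w > M} → 0` as `M → ∞` (ℕ-levels) [bookkeeping];
  **`tendsto_integral_iterate_bind_indepMH_dirac`** — `(δ_xK^N) f → π f` for EVERY `x`, EVERY positive normalised weight.
* §2 **`crnLag_hasSum_integral_diff_dirac_everyWeight`** — `Σ_n E[f(X′_{k+n}) − f(Y_{k+n})] = π f − E f(Y_k)` from `ν̂_x`;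
  **`crnLag_integral_tsum_diff_eq_dirac_everyWeight`**; **`crnLag_unbiased_dirac_everyWeight`** — `E f(Y_k) + E[Σ_{n≥0} D_{k+n}] = π f` EXACTLY, every `x`, `k`,
  EVERY FLOW `q` AND EVERY TARGET `π ≪ q` WITH A POSITIVE DENSITY: the Glynn–Rhee ∕ Jacob–O'Leary–Atchadé estimator (named only) driven by an exact
  flow sampler needs no ergodicity hypothesis whatsoever beyond `w > 0`; its expected number of correction rounds is `≤ (max(1, w(x)) + 1)/ā` with `ā`
  the printed equilibrium acceptance (`…FlowDivergenceDictionary`).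
Reading (gauge files): the two-run coupled estimator of an exact flow-driven gauge sampler started from any configuration is exactly unbiased for every
bounded observable, for every flow — its overhead is at most `(max(1, w(U)) + 1)/ā` rounds in expectation.
NOT CLAIMED: the variance (needs moments of the weight); almost-sure termination is in `…MergedForeverUnboundedWeights` (its hypothesis holds for `ν̂_x`
by §4 of `…MeetingTimeUnboundedWeights`).  No `sorry`, no new definitions, nothing cited as a fact.
-/

noncomputable section

namespace Summit.Ventures.LatticeQCDFlow.Exactness

open MeasureTheory ProbabilityTheory Function Finset Filter Set
open scoped _root_.ENNReal unitInterval Topology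
open Summit.Ventures.LatticeQCDFlow.Scoring

variable {Ω : Type*} [MeasurableSpace Ω] {q : Measure Ω} [IsProbabilityMeasure q] {w : Ω → ℝ}

/-! ## §1 The production run from a configuration converges in mean, for every weight -/

omit [IsProbabilityMeasure q] in
/-- `π{w > M} → 0` along natural levels `M → ∞` (the sets decrease to `∅`; `π` finite). [ours, bookkeeping] -/
theorem tendsto_measure_weight_gt_atTop (hw : Measurable w) (π : Measure Ω) [IsFiniteMeasure π] :
    Tendsto (fun M : ℕ => π {y | (M : ℝ) < w y}) atTop (𝓝 0) := by
  have hanti : Antitone fun M : ℕ => {y | (M : ℝ) < w y} := by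
    intro M M' hMM' y hy
    simp only [Set.mem_setOf_eq] at hy ⊢
    exact lt_of_le_of_lt (by exact_mod_cast hMM') hy
  have hmeas : ∀ M : ℕ, NullMeasurableSet {y | (M : ℝ) < w y} π := fun M => (measurableSet_lt measurable_const hw).nullMeasurableSet
  have hempty : ⋂ M : ℕ, {y | (M : ℝ) < w y} = ∅ := by
    ext y
    simp only [Set.mem_iInter, Set.mem_setOf_eq, Set.mem_empty_iff_false, iff_false, not_forall, not_lt]
    obtain ⟨M, hM⟩ := exists_nat_ge (w y)
    exact ⟨M, hM⟩
  have h := tendsto_measure_iInter_atTop hmeas hanti ⟨0, measure_ne_top π _⟩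
  rwa [hempty, measure_empty] at h

/-- **THE PRODUCTION RUN FROM A CONFIGURATION CONVERGES IN MEAN FOR EVERY BOUNDED OBSERVABLE — EVERY WEIGHT** (standard Borel `Ω`, every proposal
law; `0 < w` measurable with `π = w·q` a probability law, nothing else): `(δ_xK^N) f → π f`. [ours] -/
theorem tendsto_integral_iterate_bind_indepMH_dirac [StandardBorelSpace Ω] [Nonempty Ω] [MeasurableSingletonClass Ω] [MeasurableEq Ω]
    (hw : Measurable w) (hw0 : ∀ y, 0 < w y) [IsProbabilityMeasure (q.withDensity fun y => ENNReal.ofReal (w y))]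
    (x : Ω) {f : Ω → ℝ} (hf : Measurable f) {a c : ℝ} (ha : ∀ y, a ≤ f y) (hc : ∀ y, f y ≤ c) :
    Tendsto (fun N => ∫ y, f y ∂((fun m : Measure Ω => m.bind (indepMH q w))^[N] (Measure.dirac x))) atTop
      (𝓝 (∫ y, f y ∂(q.withDensity fun y => ENNReal.ofReal (w y)))) := by
  set π : Measure Ω := q.withDensity fun y => ENNReal.ofReal (w y) with hπ
  set c₁ : ℝ≥0∞ := ∫⁻ u, ENNReal.ofReal (min 1 (w u)) ∂q with hc₁
  have hca : 0 ≤ c - a := by linarith [ha x, hc x]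
  -- `c₁ > 0` and finite
  have hc0 : c₁ ≠ 0 := by
    intro h0
    have hae : (fun y => ENNReal.ofReal (min 1 (w y))) =ᵐ[q] 0 :=
      (lintegral_eq_zero_iff (measurable_const.min hw).ennreal_ofReal).1 h0
    have hfalse : ∀ᵐ y ∂q, False := hae.mono fun y hy => by
      have hpos : 0 < ENNReal.ofReal (min 1 (w y)) := ENNReal.ofReal_pos.2 (lt_min one_pos (hw0 y))
      simp only [Pi.zero_apply] at hy
      exact hpos.ne' hy
    rw [ae_iff] at hfalse
    simp at hfalse
  have hc1 : c₁ ≤ 1 := by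
    calc c₁ ≤ ∫⁻ _, 1 ∂q := lintegral_mono fun y => by
          rw [← ENNReal.ofReal_one]; exact ENNReal.ofReal_le_ofReal (min_le_left _ _)
      _ = 1 := by rw [lintegral_const, measure_univ, mul_one]
  rw [Metric.tendsto_atTop]
  intro ε hε
  -- choose the level `M`: `(c − a)·π{w > M} < ε/2`
  have hlev : ∀ᶠ M : ℕ in atTop, (π {y | (M : ℝ) < w y}).toReal < ε / (2 * (c - a + 1)) := by
    have ht := (ENNReal.tendsto_toReal ENNReal.zero_ne_top).comp (tendsto_measure_weight_gt_atTop hw π)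
    rw [ENNReal.toReal_zero] at ht
    exact (ht.eventually (gt_mem_nhds (by positivity)))
  obtain ⟨M, hM⟩ := hlev.exists
  -- with `M` fixed the geometric factor tends to zero
  set G : ℝ≥0∞ := 1 - c₁ / ENNReal.ofReal (max 1 (max (w x) M)) with hG
  have hG1 : G < 1 := by
    have hpos : 0 < c₁ / ENNReal.ofReal (max 1 (max (w x) M)) := ENNReal.div_pos hc0 ENNReal.ofReal_ne_top
    have hle : c₁ / ENNReal.ofReal (max 1 (max (w x) M)) ≤ 1 := by
      refine (ENNReal.div_le_iff (ENNReal.ofReal_pos.2 (lt_of_lt_of_le one_pos (le_max_left _ _))).ne' ENNReal.ofReal_ne_top).2 ?_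
      rw [one_mul]
      exact hc1.trans (by rw [← ENNReal.ofReal_one]; exact ENNReal.ofReal_le_ofReal (le_max_left _ _))
    exact ENNReal.sub_lt_self ENNReal.one_ne_top one_ne_zero hpos.ne'
  have hGpow : Tendsto (fun N : ℕ => (G ^ N).toReal) atTop (𝓝 0) := by
    have h := (ENNReal.tendsto_toReal ENNReal.zero_ne_top).comp (ENNReal.tendsto_pow_atTop_nhds_zero_of_lt_one hG1)
    rwa [ENNReal.toReal_zero] at h
  have hpow : ∀ᶠ N : ℕ in atTop, (G ^ N).toReal < ε / (2 * (c - a + 1)) := hGpow.eventually (gt_mem_nhds (by positivity))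
  obtain ⟨N₀, hN₀⟩ := eventually_atTop.1 hpow
  refine ⟨N₀, fun N hN => ?_⟩
  rw [Real.dist_eq, abs_sub_comm]
  have hbound := imh_everyStart_integral_sub_abs_le_tail (q := q) hw hw0 x hf ha hc N (M : ℝ)
  have hfin1 : π {y | (M : ℝ) < w y} ≠ ∞ := measure_ne_top π _
  have hfin2 : G ^ N ≠ ∞ := ne_top_of_le_ne_top ENNReal.one_ne_top ((pow_le_pow_left' tsub_le_self N).trans_eq (one_pow N))
  rw [ENNReal.toReal_add hfin1 hfin2] at hbound
  calc |∫ y, f y ∂π - ∫ y, f y ∂((fun m : Measure Ω => m.bind (indepMH q w))^[N] (Measure.dirac x))|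
      ≤ (c - a) * ((π {y | (M : ℝ) < w y}).toReal + (G ^ N).toReal) := hbound
    _ ≤ (c - a + 1) * ((π {y | (M : ℝ) < w y}).toReal + (G ^ N).toReal) :=
        mul_le_mul_of_nonneg_right (by linarith) (add_nonneg ENNReal.toReal_nonneg ENNReal.toReal_nonneg)
    _ < (c - a + 1) * (ε / (2 * (c - a + 1)) + ε / (2 * (c - a + 1))) :=
        mul_lt_mul_of_pos_left (add_lt_add hM (hN₀ N hN)) (by linarith)
    _ = ε := by field_simp; ring

/-! ## §2 Exact unbiasedness from every configuration, for every weight -/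

section Replicas

/-- **`Σ_n E[f(X′_{k+n}) − f(Y_{k+n})] = π f − E f(Y_k)` FROM `ν̂_x = (δ_xK) ⊗ δ_x`, EVERY WEIGHT** (standard Borel `Ω`, every proposal law). [ours] -/
theorem crnLag_hasSum_integral_diff_dirac_everyWeight [StandardBorelSpace Ω] [Nonempty Ω] [MeasurableSingletonClass Ω] [MeasurableEq Ω]
    (hw : Measurable w) (hw0 : ∀ y, 0 < w y) [IsProbabilityMeasure (q.withDensity fun y => ENNReal.ofReal (w y))]
    (Khat : Kernel (Ω × Ω) (Ω × Ω)) [IsMarkovKernel Khat]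
    (hK : ∀ z : Ω × Ω, Khat z = (q.prod (volume : Measure unitInterval)).map (fun p : Ω × unitInterval =>
      ((if (p.2 : ℝ) * w z.1 ≤ w p.1 then p.1 else z.1), (if (p.2 : ℝ) * w z.2 ≤ w p.1 then p.1 else z.2))))
    (x : Ω) [IsProbabilityMeasure (((Measure.dirac x).bind (indepMH q w)).prod (Measure.dirac x))]
    {f : Ω → ℝ} (hf : Measurable f) {a c : ℝ} (ha : ∀ y, a ≤ f y) (hc : ∀ y, f y ≤ c) (k : ℕ) :
    HasSum (fun n : ℕ => ∫ z, (f ((z (k + n)).1) - f ((z (k + n)).2))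
        ∂(Kernel.trajMeasure (X := fun _ : ℕ => Ω × Ω) (((Measure.dirac x).bind (indepMH q w)).prod (Measure.dirac x))
          (fun n : ℕ => Khat.comap (fun h : (i : ↥(Finset.Iic n)) → Ω × Ω => h ⟨n, Finset.mem_Iic.2 le_rfl⟩)
            (measurable_pi_apply _))))
      (∫ y, f y ∂(q.withDensity fun y => ENNReal.ofReal (w y)) -
        ∫ z, f ((z k).2) ∂(Kernel.trajMeasure (X := fun _ : ℕ => Ω × Ω) (((Measure.dirac x).bind (indepMH q w)).prod (Measure.dirac x))
          (fun n : ℕ => Khat.comap (fun h : (i : ↥(Finset.Iic n)) → Ω × Ω => h ⟨n, Finset.mem_Iic.2 le_rfl⟩)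
            (measurable_pi_apply _)))) := by
  haveI : Fact (Measurable w) := ⟨hw⟩
  have hbind : (Measure.dirac x).bind (indepMH q w) = indepMH q w x := Measure.dirac_bind (Kernel.measurable _) x
  set μ₀ : Measure (Ω × Ω) := ((Measure.dirac x).bind (indepMH q w)).prod (Measure.dirac x) with hμ₀
  set π : Measure Ω := q.withDensity fun y => ENNReal.ofReal (w y) with hπ
  have hsnd : μ₀.map Prod.snd = Measure.dirac x := by
    rw [hμ₀, Measure.map_snd_prod, measure_univ, one_smul]
  have hlag : μ₀.map Prod.fst = (μ₀.map Prod.snd).bind (indepMH q w) := by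
    rw [hμ₀, Measure.map_fst_prod, Measure.map_snd_prod, measure_univ, measure_univ, one_smul, one_smul]
  have hν : μ₀ = (indepMH q w x).map fun y : Ω => (y, x) := by rw [hμ₀, hbind, Measure.prod_dirac]
  set u : ℕ → ℝ := fun N => ∫ y, f y ∂((fun m : Measure Ω => m.bind (indepMH q w))^[N] (Measure.dirac x)) with hu
  have hC : ∀ y, |f y| ≤ max |a| |c| := fun y => abs_le_max_abs_abs (ha y) (hc y)
  have hterm : ∀ n, ∫ z, (f ((z (k + n)).1) - f ((z (k + n)).2))
      ∂(Kernel.trajMeasure (X := fun _ : ℕ => Ω × Ω) μ₀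
        (fun n : ℕ => Khat.comap (fun h : (i : ↥(Finset.Iic n)) → Ω × Ω => h ⟨n, Finset.mem_Iic.2 le_rfl⟩)
          (measurable_pi_apply _))) = u (k + n + 1) - u (k + n) := fun n => by
    rw [crnLag_integral_diff_eq hw0 Khat hK μ₀ hlag hf hC (k + n), hsnd]
  have hYk : ∫ z, f ((z k).2) ∂(Kernel.trajMeasure (X := fun _ : ℕ => Ω × Ω) μ₀
        (fun n : ℕ => Khat.comap (fun h : (i : ↥(Finset.Iic n)) → Ω × Ω => h ⟨n, Finset.mem_Iic.2 le_rfl⟩)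
          (measurable_pi_apply _))) = u k := by rw [crnLag_integral_snd_eq hw0 Khat hK μ₀ hf hC k, hsnd]
  simp_rw [hterm]
  rw [hYk]
  -- `u N → π f` for every weight (§1)
  have hlim : Tendsto u atTop (𝓝 (∫ y, f y ∂π)) := tendsto_integral_iterate_bind_indepMH_dirac (q := q) hw hw0 x hf ha hc
  -- summability of the corrections: the off-diagonal part of `ν̂_x` is below the model
  have hfin : ∫⁻ p in (Set.diagonal Ω)ᶜ, ENNReal.ofReal (max 1 (max (w p.1) (w p.2))) ∂μ₀ ≠ ∞ :=
    ne_top_of_le_ne_top (ENNReal.add_ne_top.2 ⟨ENNReal.ofReal_ne_top, ENNReal.one_ne_top⟩) (lintegral_offDiagonal_detLag_le hw hw0 x μ₀ hν)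
  have hpartial : ∀ N, ∑ n ∈ Finset.range N, (u (k + n + 1) - u (k + n)) = u (k + N) - u k := by
    intro N
    have := Finset.sum_range_sub (fun n => u (k + n)) N
    simpa [Nat.add_assoc] using this
  have hsumm : Summable (fun n : ℕ => u (k + n + 1) - u (k + n)) := by
    refine Summable.of_norm_bounded (g := fun n : ℕ => ∫ z, |f ((z (k + n)).1) - f ((z (k + n)).2)|
      ∂(Kernel.trajMeasure (X := fun _ : ℕ => Ω × Ω) μ₀
        (fun n : ℕ => Khat.comap (fun h : (i : ↥(Finset.Iic n)) → Ω × Ω => h ⟨n, Finset.mem_Iic.2 le_rfl⟩)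
          (measurable_pi_apply _))))
      (crnLag_summable_integral_abs_diff_unboundedWeights hw hw0 Khat hK μ₀ hfin hf ha hc k) (fun n => ?_)
    rw [← hterm n, Real.norm_eq_abs]
    exact abs_integral_le_integral_abs
  have hlim2 : Tendsto (fun N => ∑ n ∈ Finset.range N, (u (k + n + 1) - u (k + n))) atTop
      (𝓝 (∫ y, f y ∂π - u k)) := by
    simp_rw [hpartial]
    have hshift : Tendsto (fun N => u (k + N)) atTop (𝓝 (∫ y, f y ∂π)) :=
      hlim.comp (tendsto_atTop_atTop_of_monotone (fun _ _ h => Nat.add_le_add_left h k)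
        fun N => ⟨N, Nat.le_add_left N k⟩)
    exact hshift.sub_const (u k)
  have heq : ∑' n, (u (k + n + 1) - u (k + n)) = ∫ y, f y ∂π - u k :=
    tendsto_nhds_unique hsumm.hasSum.tendsto_sum_nat hlim2
  rw [← heq]
  exact hsumm.hasSum

/-- **`E[Σ_{n≥0} D_{k+n}] = π f − E f(Y_k)` FROM `ν̂_x`, EVERY WEIGHT** (dominated convergence with the summable envelope). [ours] -/
theorem crnLag_integral_tsum_diff_eq_dirac_everyWeight [StandardBorelSpace Ω] [Nonempty Ω] [MeasurableSingletonClass Ω] [MeasurableEq Ω]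
    (hw : Measurable w) (hw0 : ∀ y, 0 < w y) [IsProbabilityMeasure (q.withDensity fun y => ENNReal.ofReal (w y))]
    (Khat : Kernel (Ω × Ω) (Ω × Ω)) [IsMarkovKernel Khat]
    (hK : ∀ z : Ω × Ω, Khat z = (q.prod (volume : Measure unitInterval)).map (fun p : Ω × unitInterval =>
      ((if (p.2 : ℝ) * w z.1 ≤ w p.1 then p.1 else z.1), (if (p.2 : ℝ) * w z.2 ≤ w p.1 then p.1 else z.2))))
    (x : Ω) [IsProbabilityMeasure (((Measure.dirac x).bind (indepMH q w)).prod (Measure.dirac x))]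
    {f : Ω → ℝ} (hf : Measurable f) {a c : ℝ} (ha : ∀ y, a ≤ f y) (hc : ∀ y, f y ≤ c) (k : ℕ) :
    ∫ z, (∑' n : ℕ, (f ((z (k + n)).1) - f ((z (k + n)).2)))
        ∂(Kernel.trajMeasure (X := fun _ : ℕ => Ω × Ω) (((Measure.dirac x).bind (indepMH q w)).prod (Measure.dirac x))
          (fun n : ℕ => Khat.comap (fun h : (i : ↥(Finset.Iic n)) → Ω × Ω => h ⟨n, Finset.mem_Iic.2 le_rfl⟩)
            (measurable_pi_apply _))) =
      ∫ y, f y ∂(q.withDensity fun y => ENNReal.ofReal (w y)) -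
        ∫ z, f ((z k).2) ∂(Kernel.trajMeasure (X := fun _ : ℕ => Ω × Ω) (((Measure.dirac x).bind (indepMH q w)).prod (Measure.dirac x))
          (fun n : ℕ => Khat.comap (fun h : (i : ↥(Finset.Iic n)) → Ω × Ω => h ⟨n, Finset.mem_Iic.2 le_rfl⟩)
            (measurable_pi_apply _))) := by
  haveI : Fact (Measurable w) := ⟨hw⟩
  have hbind : (Measure.dirac x).bind (indepMH q w) = indepMH q w x := Measure.dirac_bind (Kernel.measurable _) x
  set μ₀ : Measure (Ω × Ω) := ((Measure.dirac x).bind (indepMH q w)).prod (Measure.dirac x) with hμ₀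
  set P := Kernel.trajMeasure (X := fun _ : ℕ => Ω × Ω) μ₀
        (fun n : ℕ => Khat.comap (fun h : (i : ↥(Finset.Iic n)) → Ω × Ω => h ⟨n, Finset.mem_Iic.2 le_rfl⟩)
          (measurable_pi_apply _)) with hP
  have hν : μ₀ = (indepMH q w x).map fun y : Ω => (y, x) := by rw [hμ₀, hbind, Measure.prod_dirac]
  have hDm : ∀ n, Measurable (fun z : ℕ → Ω × Ω => f ((z (k + n)).1) - f ((z (k + n)).2)) := fun n =>
    (hf.comp (measurable_fst.comp (measurable_pi_apply _))).sub (hf.comp (measurable_snd.comp (measurable_pi_apply _)))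
  have hDb : ∀ n (z : ℕ → Ω × Ω), |f ((z (k + n)).1) - f ((z (k + n)).2)| ≤ c - a := by
    intro n z
    have h1 := ha ((z (k + n)).1); have h2 := hc ((z (k + n)).1)
    have h3 := ha ((z (k + n)).2); have h4 := hc ((z (k + n)).2)
    exact abs_le.2 ⟨by linarith, by linarith⟩
  have hDi : ∀ n, Integrable (fun z : ℕ → Ω × Ω => f ((z (k + n)).1) - f ((z (k + n)).2)) P := fun n =>
    integrable_of_bounded P (hDm n) (hDb n)
  have hfin : ∫⁻ p in (Set.diagonal Ω)ᶜ, ENNReal.ofReal (max 1 (max (w p.1) (w p.2))) ∂μ₀ ≠ ∞ :=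
    ne_top_of_le_ne_top (ENNReal.add_ne_top.2 ⟨ENNReal.ofReal_ne_top, ENNReal.one_ne_top⟩) (lintegral_offDiagonal_detLag_le hw hw0 x μ₀ hν)
  have hsum : Summable (fun n => ∫ z, ‖f ((z (k + n)).1) - f ((z (k + n)).2)‖ ∂P) := by
    simp_rw [Real.norm_eq_abs]
    exact crnLag_summable_integral_abs_diff_unboundedWeights hw hw0 Khat hK μ₀ hfin hf ha hc k
  rw [← integral_tsum_of_summable_integral_norm hDi hsum]
  exact (crnLag_hasSum_integral_diff_dirac_everyWeight hw hw0 Khat hK x hf ha hc k).tsum_eq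

/-- **THE COUPLED ESTIMATOR FROM ANY CONFIGURATION IS EXACTLY UNBIASED FOR EVERY FLOW AND EVERY TARGET**: `0 < w` measurable with `π = w·q` a
probability law — NO bound, NO moment condition —; production run at `x`, leading run one independent update out of `x`, common random numbers;
then `E f(Y_k) + E[Σ_{n≥0}(f(X′_{k+n}) − f(Y_{k+n}))] = π f` EXACTLY for every `x`, every `k` and every bounded measurable `f`. [ours] -/
theorem crnLag_unbiased_dirac_everyWeight [StandardBorelSpace Ω] [Nonempty Ω] [MeasurableSingletonClass Ω] [MeasurableEq Ω]
    (hw : Measurable w) (hw0 : ∀ y, 0 < w y) [IsProbabilityMeasure (q.withDensity fun y => ENNReal.ofReal (w y))]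
    (Khat : Kernel (Ω × Ω) (Ω × Ω)) [IsMarkovKernel Khat]
    (hK : ∀ z : Ω × Ω, Khat z = (q.prod (volume : Measure unitInterval)).map (fun p : Ω × unitInterval =>
      ((if (p.2 : ℝ) * w z.1 ≤ w p.1 then p.1 else z.1), (if (p.2 : ℝ) * w z.2 ≤ w p.1 then p.1 else z.2))))
    (x : Ω) [IsProbabilityMeasure (((Measure.dirac x).bind (indepMH q w)).prod (Measure.dirac x))]
    {f : Ω → ℝ} (hf : Measurable f) {a c : ℝ} (ha : ∀ y, a ≤ f y) (hc : ∀ y, f y ≤ c) (k : ℕ) :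
    ∫ z, f ((z k).2) ∂(Kernel.trajMeasure (X := fun _ : ℕ => Ω × Ω) (((Measure.dirac x).bind (indepMH q w)).prod (Measure.dirac x))
          (fun n : ℕ => Khat.comap (fun h : (i : ↥(Finset.Iic n)) → Ω × Ω => h ⟨n, Finset.mem_Iic.2 le_rfl⟩)
            (measurable_pi_apply _))) +
      ∫ z, (∑' n : ℕ, (f ((z (k + n)).1) - f ((z (k + n)).2)))
        ∂(Kernel.trajMeasure (X := fun _ : ℕ => Ω × Ω) (((Measure.dirac x).bind (indepMH q w)).prod (Measure.dirac x))
          (fun n : ℕ => Khat.comap (fun h : (i : ↥(Finset.Iic n)) → Ω × Ω => h ⟨n, Finset.mem_Iic.2 le_rfl⟩)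
            (measurable_pi_apply _))) =
      ∫ y, f y ∂(q.withDensity fun y => ENNReal.ofReal (w y)) := by
  rw [crnLag_integral_tsum_diff_eq_dirac_everyWeight hw hw0 Khat hK x hf ha hc k]
  ring

end Replicas

end Summit.Ventures.LatticeQCDFlow.Exactness

end
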